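import Summits.Ventures.PercRepro.Night2LocalLine
import Summits.Ventures.PercRepro.Night2ShadowWrapper

/-!
# PercRepro — `ShadowHall M 4 2` for every finite matroid (night-2, gen 7)

**`shadowHall_four_two`**: the diagonal shadow form of C-025 at `q = 2` — every sub-family `𝒜` of the bottom
sets `Uq M 4 2` has at least `Φ(4, 2) · #𝒜 = (4/3) · #𝒜` middle-level sets above it — for EVERY finite matroid:
loops are removed by `shadowHall_of_delete_loop` (induction on the number of ground elements), and loopless
matroids are `shadowHall_four_two_of_loopless` (the case split of `Night2LocalTwoSplit.lean`: (A) a carrying line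
with two elements outside, (B) thin carrying lines, (C2) one element outside the plane, (C1) the line case).
Together with `shadowHall_three_one` (`q = 1`) the rows `q = 1, 2` of the shadow form are tree theorems.
-/

open scoped Matroid

namespace PercRepro.Shadow

open Finset PerFlat ThmH

variable {α : Type*} [DecidableEq α] {M : Matroid α} [M.Finite]

omit [DecidableEq α] in
/-- A matroid with no loop has every singleton of the ground set independent. -/
theorem indep_singleton_of_no_loop (hL : ¬ ∃ ℓ ∈ M.E, ¬ M.Indep {ℓ}) :
    ∀ e ∈ gr M, M.Indep {e} := by
  intro e he
  by_contra hind
  apply hL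
  exact ⟨e, by rw [← Finset.mem_coe, coe_gr] at he; exact he, hind⟩

omit [M.Finite] in
/-- **THE DIAGONAL SHADOW FORM OF C-025 AT `q = 2`, for every finite matroid.** -/
theorem shadowHall_four_two {α : Type} [DecidableEq α] (M : Matroid α) [M.Finite] :
    ShadowHall M 4 2 (phiK 4 2) := by
  classical
  suffices h : ∀ (n : ℕ) (N : Matroid α) [N.Finite], (gr N).card ≤ n → ShadowHall N 4 2 (phiK 4 2) from
    h (gr M).card M le_rfl
  intro n
  induction n using Nat.strong_induction_on with
  | _ n ihn =>
    intro N _ hn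
    by_cases hL : ∃ ℓ ∈ N.E, ¬ N.Indep {ℓ}
    · obtain ⟨ℓ, hℓ, hl⟩ := hL
      have hℓg : ℓ ∈ gr N := by rw [← Finset.mem_coe, coe_gr]; exact hℓ
      have hcard : (gr (N ＼ ({ℓ} : Set α))).card < n := by
        rw [gr_delete, Finset.card_erase_of_mem hℓg]
        have : 0 < (gr N).card := Finset.card_pos.2 ⟨ℓ, hℓg⟩
        omega
      exact shadowHall_of_delete_loop hℓ hl (phiK_diag_nonneg 2) (ihn _ hcard (N ＼ ({ℓ} : Set α)) le_rfl)
    · exact shadowHall_four_two_of_loopless (indep_singleton_of_no_loop hL)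

/-- **C-025 at `(4, 2)` on every finite matroid, from the shadow form** (the body of the row, as in
`c025_of_shadowHall`). -/
theorem c025_four_two_of_shadow {α : Type} [DecidableEq α] (M : Matroid α) [M.Finite] :
    phiK 4 2 * ({A : Set α | A ⊆ M.E ∧ M.eRk A = ((2 + 2 : ℕ) : ℕ∞) ∧ M.eRk (M.E \ A) = ((2 : ℕ) : ℕ∞)}.ncard : ℚ) ≤
      ({A : Set α | A ⊆ M.E ∧ ((2 : ℕ) : ℕ∞) < M.eRk A ∧ M.eRk A < ((2 + 2 : ℕ) : ℕ∞)}.ncard : ℚ) :=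
  c025_of_shadowHall (shadowHall_four_two M)

end PercRepro.Shadow
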